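import Summits.CriticalPhenomena.PercolationContinuityZ3.Theorems.PercNearOneGluingNoHeavyLowerTailIncStarRootStarMixture
import Literature.Probability.LatticeModels.SahiIndependentAtoms
import Literature.Probability.LatticeModels.SahiThirdOrderCorrelation
import HarnessLib

/-!
# The base case of the inner edge induction: the increasing star of a "star of blocks"

Support file for the Sahi programme (`--supports stmt-CriticalPhenomena-4575`, prover prim-sahi-p2 gen 16).  No definitions, no named
facts, no sorries; standard axioms.  Companion of `PercNearOneGluingNoHeavyLowerTailIncStarSlackEdgeInduction`.

When every non-loop pair missing the root `s` has weight `0` or `1`, the graph `G − s` is almost surely deterministic: writing `H` for the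
graph of the weight-`1` pairs missing `s`, on the almost-sure set `{s ↔ t}` holds iff `t = s` or some root pair `s(s,u)` is open with `u`
joined to `t` in `H` (`openConn_iff_rootStar_of_det`).  These ROOT-STAR PROXY events are increasing, determined by the root pairs into the
`H`-class of the target, and two of them are either EQUAL (same class) or determined by DISJOINT sets of pairs; Sahi's cubic of three such
events is nonnegative (`sahiE3_rootStarProxy_nonneg`: the diagonal formula `E₃(A,A,A) = a(1−a)(2−a)`, or independence of two slots plus
Harris, `prodBernoulli_sahiE3_nonneg_of_determinedBy`).  Moreover every pinned weight `w^O` of the root-star mixture is then deterministic off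
the loops, so its star cubic vanishes (`IncStar.sahiE3_hub_eq_zero_of_closed`).  Hence the BASE CASE of
`IncStar.rootStarMixture_of_slackEdgeBernstein` (file `…IncStarSlackEdgeInduction`) holds unconditionally (`rootStarMixture_base`), so that
the increasing star follows from the single hypothesis `(MQ-Bern)` (corollary in `…IncStarSlackEdgeStar`).
-/

noncomputable section

namespace Summit.CriticalPhenomena.PercolationContinuityZ3.Theorems

namespace IncStar

open Finset MeasureTheory Literature.Probability.Percolation Literature.Probability.LatticeModels EdgeInduction
open scoped Classical

variable {n : ℕ}

/-- `E₃` only sees the events through an almost-sure set: triples agreeing on a set of probability `1` have the same `E₃`. [folklore] -/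
theorem sahiE3_congr_of_sure {μ : Measure (BondConfig (Fin n))} [IsProbabilityMeasure μ] {G : Set (BondConfig (Fin n))}
    (hGm : MeasurableSet G) (hG : μ.real G = 1) {A B C A' B' C' : Set (BondConfig (Fin n))}
    (hA : ∀ ω ∈ G, ω ∈ A ↔ ω ∈ A') (hB : ∀ ω ∈ G, ω ∈ B ↔ ω ∈ B') (hC : ∀ ω ∈ G, ω ∈ C ↔ ω ∈ C') :
    sahiE3 μ A B C = sahiE3 μ A' B' C' := by
  have key : ∀ S S' : Set (BondConfig (Fin n)), (∀ ω ∈ G, ω ∈ S ↔ ω ∈ S') → μ.real S = μ.real S' := by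
    intro S S' h
    rw [real_eq_real_inter_of_real_eq_one hGm hG S, real_eq_real_inter_of_real_eq_one hGm hG S']
    congr 1
    ext ω
    simp only [Set.mem_inter_iff]
    constructor
    · rintro ⟨hS, hω⟩; exact ⟨(h ω hω).1 hS, hω⟩
    · rintro ⟨hS, hω⟩; exact ⟨(h ω hω).2 hS, hω⟩
  have hAB : ∀ ω ∈ G, ω ∈ A ∩ B ↔ ω ∈ A' ∩ B' := fun ω hω => by simp only [Set.mem_inter_iff, hA ω hω, hB ω hω]
  have hAC : ∀ ω ∈ G, ω ∈ A ∩ C ↔ ω ∈ A' ∩ C' := fun ω hω => by simp only [Set.mem_inter_iff, hA ω hω, hC ω hω]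
  have hBC : ∀ ω ∈ G, ω ∈ B ∩ C ↔ ω ∈ B' ∩ C' := fun ω hω => by simp only [Set.mem_inter_iff, hB ω hω, hC ω hω]
  have hABC : ∀ ω ∈ G, ω ∈ A ∩ B ∩ C ↔ ω ∈ A' ∩ B' ∩ C' := fun ω hω => by
    simp only [Set.mem_inter_iff, hA ω hω, hB ω hω, hC ω hω]
  simp only [sahiE3_def]
  rw [key _ _ hABC, key _ _ hA, key _ _ hB, key _ _ hC, key _ _ hBC, key _ _ hAC, key _ _ hAB]

/-- A graph built from pairs missing `s` has no edge at `s`. [folklore] -/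
theorem not_adj_root_of_missing (w : Sym2 (Fin n) → unitInterval) (s v : Fin n) :
    ¬ (SimpleGraph.fromEdgeSet {e : Sym2 (Fin n) | w e = 1 ∧ s ∉ e}).Adj v s := by
  intro h
  rw [SimpleGraph.fromEdgeSet_adj] at h
  exact h.1.2 (Sym2.mem_mk_right v s)

/-- … hence `s` is reachable in it only from itself. [folklore] -/
theorem eq_root_of_reachable_missing (w : Sym2 (Fin n) → unitInterval) {s u : Fin n}
    (h : (SimpleGraph.fromEdgeSet {e : Sym2 (Fin n) | w e = 1 ∧ s ∉ e}).Reachable u s) : u = s := by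
  by_contra hus
  obtain ⟨p⟩ := h
  obtain ⟨d, -, -, hd2⟩ := p.exists_boundary_dart {v | v ≠ s} hus (fun h => h rfl)
  have hds : d.toProd.2 = s := by
    by_contra h; exact hd2 h
  have hadj := d.adj
  rw [hds] at hadj
  exact not_adj_root_of_missing w s _ hadj

/-- **The a.s. shape of the root's connections when `G − s` is deterministic.**  If every non-loop pair missing `s` has weight `0` or
`1`, then on the almost-sure set (weight-`1` pairs open, weight-`0` pairs closed) `{s ↔ t}` holds iff `t = s` or some open root pair
`s(s,u)` has `u` joined to `t` by weight-`1` pairs missing `s`. [this work] -/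
theorem openConn_iff_rootStar_of_det (w : Sym2 (Fin n) → unitInterval) (s : Fin n)
    (hdet : ∀ e : Sym2 (Fin n), ¬ e.IsDiag → s ∉ e → w e = 0 ∨ w e = 1)
    {ω : BondConfig (Fin n)} (hω1 : ∀ e, w e = 1 → e ∈ ω) (hω0 : ∀ e, w e = 0 → e ∉ ω) (t : Fin n) :
    ω ∈ openConn s t ↔
      t = s ∨ ∃ u, u ≠ s ∧ s(s, u) ∈ ω ∧ (SimpleGraph.fromEdgeSet {e : Sym2 (Fin n) | w e = 1 ∧ s ∉ e}).Reachable u t := by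
  set H := SimpleGraph.fromEdgeSet {e : Sym2 (Fin n) | w e = 1 ∧ s ∉ e} with hH
  constructor
  · intro h
    simp only [openConn, Set.mem_setOf_eq] at h
    by_cases hts : t = s
    · exact Or.inl hts
    right
    obtain ⟨p⟩ := h
    by_contra hnot
    have htU : t ∉ ({v : Fin n | v = s ∨ ∃ u, u ≠ s ∧ s(s, u) ∈ ω ∧ H.Reachable u v} : Set (Fin n)) := by
      rintro (h1 | h2)
      · exact hts h1
      · exact hnot h2
    obtain ⟨d, -, hdU, hdU'⟩ := p.exists_boundary_dart _ (Or.inl rfl) htU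
    have hadj := d.adj
    rw [openGraph_adj] at hadj
    apply hdU'
    by_cases hfs : d.toProd.1 = s
    · right
      refine ⟨d.toProd.2, fun h => hadj.2 (hfs.trans h.symm), ?_, SimpleGraph.Reachable.refl _⟩
      rw [← hfs]; exact hadj.1
    · rcases hdU with h1 | ⟨u, hus, hsu, hru⟩
      · exact absurd h1 hfs
      by_cases hss : d.toProd.2 = s
      · exact Or.inl hss
      right
      refine ⟨u, hus, hsu, hru.trans (SimpleGraph.Adj.reachable ?_)⟩
      have hsg : s ∉ s(d.toProd.1, d.toProd.2) := by
        rw [Sym2.mem_iff]; rintro (h | h)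
        · exact hfs h.symm
        · exact hss h.symm
      have hnd : ¬ (s(d.toProd.1, d.toProd.2)).IsDiag := by rw [Sym2.mk_isDiag_iff]; exact hadj.2
      rcases hdet _ hnd hsg with h0 | h1
      · exact absurd hadj.1 (hω0 _ h0)
      · rw [hH, SimpleGraph.fromEdgeSet_adj]
        exact ⟨⟨h1, hsg⟩, hadj.2⟩
  · rintro (rfl | ⟨u, hus, hsu, hru⟩)
    · simp only [openConn, Set.mem_setOf_eq]
      exact SimpleGraph.Reachable.refl _
    · simp only [openConn, Set.mem_setOf_eq]
      have h1 : (openGraph ω).Adj s u := by rw [openGraph_adj]; exact ⟨hsu, fun h => hus h.symm⟩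
      have h2 : H ≤ openGraph ω := by
        intro a b hab
        rw [hH, SimpleGraph.fromEdgeSet_adj] at hab
        rw [openGraph_adj]
        exact ⟨hω1 _ hab.1.1, hab.2⟩
      exact h1.reachable.trans (hru.mono h2)

/-- The root-star proxy events are increasing. [folklore] -/
theorem rootStarProxy_isUpperSet (s t : Fin n) (H : SimpleGraph (Fin n)) :
    IsUpperSet {ω : BondConfig (Fin n) | t = s ∨ ∃ u, u ≠ s ∧ s(s, u) ∈ ω ∧ H.Reachable u t} := by
  intro ω ω' hle h
  rcases h with h | ⟨u, hus, hsu, hru⟩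
  · exact Or.inl h
  · exact Or.inr ⟨u, hus, hle hsu, hru⟩

/-- The root-star proxy event of `t` is determined by the root pairs into the `H`-class of `t`. [folklore] -/
theorem rootStarProxy_determinedBy (s t : Fin n) (H : SimpleGraph (Fin n)) :
    DeterminedBy {ω : BondConfig (Fin n) | t = s ∨ ∃ u, u ≠ s ∧ s(s, u) ∈ ω ∧ H.Reachable u t}
      (↑(Finset.univ.filter fun g : Sym2 (Fin n) => ∃ u, u ≠ s ∧ g = s(s, u) ∧ H.Reachable u t) : Set (Sym2 (Fin n))) := by
  rw [determinedBy_iff]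
  intro ω ω' heq
  have key : ∀ u, u ≠ s → H.Reachable u t → (s(s, u) ∈ ω ↔ s(s, u) ∈ ω') := by
    intro u hus hru
    have hg : s(s, u) ∈ (↑(Finset.univ.filter fun g : Sym2 (Fin n) => ∃ u, u ≠ s ∧ g = s(s, u) ∧ H.Reachable u t) :
        Set (Sym2 (Fin n))) := by
      rw [Finset.mem_coe, Finset.mem_filter]
      exact ⟨Finset.mem_univ _, u, hus, rfl, hru⟩
    constructor
    · intro h
      have h' : s(s, u) ∈ ω' ∩ (↑(Finset.univ.filter fun g : Sym2 (Fin n) => ∃ u, u ≠ s ∧ g = s(s, u) ∧ H.Reachable u t) :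
          Set (Sym2 (Fin n))) := by
        rw [← heq]; exact ⟨h, hg⟩
      exact h'.1
    · intro h
      have h' : s(s, u) ∈ ω ∩ (↑(Finset.univ.filter fun g : Sym2 (Fin n) => ∃ u, u ≠ s ∧ g = s(s, u) ∧ H.Reachable u t) :
          Set (Sym2 (Fin n))) := by
        rw [heq]; exact ⟨h, hg⟩
      exact h'.1
  simp only [Set.mem_setOf_eq]
  constructor
  · rintro (h | ⟨u, hus, hsu, hru⟩)
    · exact Or.inl h
    · exact Or.inr ⟨u, hus, (key u hus hru).1 hsu, hru⟩
  · rintro (h | ⟨u, hus, hsu, hru⟩)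
    · exact Or.inl h
    · exact Or.inr ⟨u, hus, (key u hus hru).2 hsu, hru⟩

/-- Two root-star proxy events are EQUAL or determined by DISJOINT sets of root pairs (when `H` has no edge at the root). [this work] -/
theorem rootStarProxy_eq_or_disjoint (s t t' : Fin n) (H : SimpleGraph (Fin n)) (hH : ∀ u, H.Reachable u s → u = s) :
    {ω : BondConfig (Fin n) | t = s ∨ ∃ u, u ≠ s ∧ s(s, u) ∈ ω ∧ H.Reachable u t} =
        {ω : BondConfig (Fin n) | t' = s ∨ ∃ u, u ≠ s ∧ s(s, u) ∈ ω ∧ H.Reachable u t'} ∨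
      Disjoint (Finset.univ.filter fun g : Sym2 (Fin n) => ∃ u, u ≠ s ∧ g = s(s, u) ∧ H.Reachable u t)
        (Finset.univ.filter fun g : Sym2 (Fin n) => ∃ u, u ≠ s ∧ g = s(s, u) ∧ H.Reachable u t') := by
  have hempty : ∀ r : Fin n, r = s →
      (Finset.univ.filter fun g : Sym2 (Fin n) => ∃ u, u ≠ s ∧ g = s(s, u) ∧ H.Reachable u r) = ∅ := by
    rintro r rfl
    refine Finset.filter_eq_empty_iff.2 fun g _ => ?_
    rintro ⟨u, hus, -, hru⟩
    exact hus (hH u hru)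
  by_cases ht : t = s
  · right; rw [hempty t ht]; exact Finset.disjoint_empty_left _
  by_cases ht' : t' = s
  · right; rw [hempty t' ht']; exact Finset.disjoint_empty_right _
  by_cases hr : H.Reachable t t'
  · left
    ext ω
    simp only [Set.mem_setOf_eq, ht, ht', false_or]
    constructor
    · rintro ⟨u, hus, hsu, hru⟩; exact ⟨u, hus, hsu, hru.trans hr⟩
    · rintro ⟨u, hus, hsu, hru⟩; exact ⟨u, hus, hsu, hru.trans hr.symm⟩
  · right
    refine Finset.disjoint_left.2 fun g hg hg' => ?_
    rw [Finset.mem_filter] at hg hg'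
    obtain ⟨-, u, hus, rfl, hru⟩ := hg
    obtain ⟨-, u', hu's, hEq, hru'⟩ := hg'
    rw [Sym2.eq_iff] at hEq
    rcases hEq with ⟨-, huu⟩ | ⟨hsu', -⟩
    · subst huu; exact hr (hru.symm.trans hru')
    · exact hu's hsu'.symm

/-- **Sahi's cubic of three root-star proxy events is nonnegative** (any weight; `H` without edges at the root): either all three events
coincide (`E₃(A,A,A) = a(1−a)(2−a)`), or two of them are determined by disjoint sets of pairs — independent under the product law — and
`prodBernoulli_sahiE3_nonneg_of_determinedBy` (independence + Harris) applies. [this work] -/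
theorem sahiE3_rootStarProxy_nonneg (w : Sym2 (Fin n) → unitInterval) (s b c y : Fin n) (H : SimpleGraph (Fin n))
    (hH : ∀ u, H.Reachable u s → u = s) :
    0 ≤ sahiE3 (prodBernoulli w)
      {ω : BondConfig (Fin n) | b = s ∨ ∃ u, u ≠ s ∧ s(s, u) ∈ ω ∧ H.Reachable u b}
      {ω : BondConfig (Fin n) | c = s ∨ ∃ u, u ≠ s ∧ s(s, u) ∈ ω ∧ H.Reachable u c}
      {ω : BondConfig (Fin n) | y = s ∨ ∃ u, u ≠ s ∧ s(s, u) ∈ ω ∧ H.Reachable u y} := by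
  have hup := fun t => rootStarProxy_isUpperSet s t H
  have hdb := fun t => rootStarProxy_determinedBy s t H
  have hm : ∀ t : Fin n, MeasurableSet {ω : BondConfig (Fin n) | t = s ∨ ∃ u, u ≠ s ∧ s(s, u) ∈ ω ∧ H.Reachable u t} :=
    fun t => MeasurableSet.of_discrete
  rcases rootStarProxy_eq_or_disjoint s b c H hH with hbc | hbc
  · rcases rootStarProxy_eq_or_disjoint s b y H hH with hby | hby
    · rw [← hbc, ← hby, sahiE3_self]
      have h0 : 0 ≤ (prodBernoulli w).real {ω : BondConfig (Fin n) | b = s ∨ ∃ u, u ≠ s ∧ s(s, u) ∈ ω ∧ H.Reachable u b} :=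
        measureReal_nonneg
      have h1 : (prodBernoulli w).real {ω : BondConfig (Fin n) | b = s ∨ ∃ u, u ≠ s ∧ s(s, u) ∈ ω ∧ H.Reachable u b} ≤ 1 :=
        measureReal_le_one
      have h2 : 0 ≤ 1 - (prodBernoulli w).real {ω : BondConfig (Fin n) | b = s ∨ ∃ u, u ≠ s ∧ s(s, u) ∈ ω ∧ H.Reachable u b} :=
        sub_nonneg.2 h1
      have h3 : 0 ≤ 2 - (prodBernoulli w).real {ω : BondConfig (Fin n) | b = s ∨ ∃ u, u ≠ s ∧ s(s, u) ∈ ω ∧ H.Reachable u b} := by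
        linarith
      exact mul_nonneg (mul_nonneg h0 h2) h3
    · rw [sahiE3_comm₂₃]
      exact prodBernoulli_sahiE3_nonneg_of_determinedBy w hby (hdb b) (hdb y) (hup b) (hup y) (hup c) (hm b) (hm y) (hm c)
  · exact prodBernoulli_sahiE3_nonneg_of_determinedBy w hbc (hdb b) (hdb c) (hup b) (hup c) (hup y) (hm b) (hm c) (hm y)

/-- **The increasing star of a star of blocks.**  If every non-loop pair missing the root has weight `0` or `1`, then
`E₃({s↔b},{s↔c},{s↔y}) ≥ 0`. [this work] -/
theorem incStar_nonneg_of_nonRootDet (w : Sym2 (Fin n) → unitInterval) (s b c y : Fin n)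
    (hdet : ∀ e : Sym2 (Fin n), ¬ e.IsDiag → s ∉ e → w e = 0 ∨ w e = 1) :
    0 ≤ sahiE3 (prodBernoulli w) (openConn s b) (openConn s c) (openConn s y) := by
  have hGm : MeasurableSet ({ω : BondConfig (Fin n) | ∀ e, w e = 1 → e ∈ ω} ∩ {ω | ∀ e, w e = 0 → e ∉ ω}) :=
    MeasurableSet.of_discrete
  have hG := real_sureSet w
  have hiff : ∀ t : Fin n, ∀ ω ∈ ({ω : BondConfig (Fin n) | ∀ e, w e = 1 → e ∈ ω} ∩ {ω | ∀ e, w e = 0 → e ∉ ω}),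
      ω ∈ openConn s t ↔ ω ∈ {ω : BondConfig (Fin n) | t = s ∨ ∃ u, u ≠ s ∧ s(s, u) ∈ ω ∧
        (SimpleGraph.fromEdgeSet {e : Sym2 (Fin n) | w e = 1 ∧ s ∉ e}).Reachable u t} :=
    fun t ω hω => openConn_iff_rootStar_of_det w s hdet hω.1 hω.2 t
  rw [sahiE3_congr_of_sure hGm hG (hiff b) (hiff c) (hiff y)]
  exact sahiE3_rootStarProxy_nonneg w s b c y _ fun u hu => eq_root_of_reachable_missing w hu

/-- **THE BASE CASE of the inner edge induction holds.**  If every non-loop pair missing the root has weight `0` or `1`, every pinned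
weight `w^O` of the root-star mixture is deterministic off the loops, its star cubic vanishes, and `(MQ)` reduces to the increasing star of
a star of blocks (`incStar_nonneg_of_nonRootDet`). [this work] -/
theorem rootStarMixture_base (w : Sym2 (Fin n) → unitInterval) (s b c y : Fin n)
    (hdet : ∀ e : Sym2 (Fin n), ¬ e.IsDiag → s ∉ e → w e = 0 ∨ w e = 1) :
    ∑ O ∈ ((fracEdges w).filter fun f => ¬ f.IsDiag ∧ s ∈ f).powerset,
        (∏ f ∈ O, (w f : ℝ)) * (∏ f ∈ ((fracEdges w).filter fun f => ¬ f.IsDiag ∧ s ∈ f) \ O, (1 - (w f : ℝ))) *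
          sahiE3 (prodBernoulli (fun f => if f ∈ O then (1 : unitInterval)
              else if f ∈ ((fracEdges w).filter fun f => ¬ f.IsDiag ∧ s ∈ f) then 0 else w f))
            (openConn s b) (openConn s c) (openConn s y) ≤
      sahiE3 (prodBernoulli w) (openConn s b) (openConn s c) (openConn s y) := by
  have hzero : ∀ O ∈ ((fracEdges w).filter fun f => ¬ f.IsDiag ∧ s ∈ f).powerset,
      sahiE3 (prodBernoulli (fun f => if f ∈ O then (1 : unitInterval)
          else if f ∈ ((fracEdges w).filter fun f => ¬ f.IsDiag ∧ s ∈ f) then 0 else w f))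
        (openConn s b) (openConn s c) (openConn s y) = 0 := by
    intro O hO
    have hOF := Finset.mem_powerset.1 hO
    refine sahiE3_hub_eq_zero_of_closed _ s (fun z v hz hv hzv => ?_) b c y
    have hnd : ¬ (s(z, v)).IsDiag := by rw [Sym2.mk_isDiag_iff]; exact hzv
    -- the pinned weight of `s(z,v)` is `0` or `1`, and `1` would put `v` in the weight-1 component of `s`
    have hone : (if s(z, v) ∈ O then (1 : unitInterval)
        else if s(z, v) ∈ ((fracEdges w).filter fun f => ¬ f.IsDiag ∧ s ∈ f) then 0 else w s(z, v)) ≠ 1 := by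
      intro h1
      refine hv (hz.trans (SimpleGraph.Adj.reachable ?_))
      rw [SimpleGraph.fromEdgeSet_adj]
      exact ⟨h1, hzv⟩
    show (if s(z, v) ∈ O then (1 : unitInterval)
        else if s(z, v) ∈ ((fracEdges w).filter fun f => ¬ f.IsDiag ∧ s ∈ f) then 0 else w s(z, v)) = 0
    by_cases h1 : s(z, v) ∈ O
    · rw [if_pos h1] at hone; exact absurd rfl hone
    by_cases h2 : s(z, v) ∈ ((fracEdges w).filter fun f => ¬ f.IsDiag ∧ s ∈ f)
    · rw [if_neg h1, if_pos h2]
    rw [if_neg h1, if_neg h2] at hone ⊢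
    have h01 : w s(z, v) = 0 ∨ w s(z, v) = 1 := by
      by_cases hs : s ∈ s(z, v)
      · exact eq_zero_or_one_of_not_mem_fracEdges fun hfr => h2 (Finset.mem_filter.2 ⟨hfr, hnd, hs⟩)
      · exact hdet _ hnd hs
    exact h01.resolve_right hone
  rw [Finset.sum_eq_zero fun O hO => by rw [hzero O hO, mul_zero]]
  exact incStar_nonneg_of_nonRootDet w s b c y hdet

end IncStar

end Summit.CriticalPhenomena.PercolationContinuityZ3.Theorems
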